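import Literature.MathematicalPhysics.QuantumFieldTheory.Balaban1983to89.B13InverseLettersOnCoerciveBall
import Literature.MathematicalPhysics.QuantumFieldTheory.Balaban1983to89.B13OpsYPencilGreenPrimeSym
import Literature.MathematicalPhysics.QuantumFieldTheory.Balaban1983to89.B13SiteReadingNumerals
import Literature.MathematicalPhysics.QuantumFieldTheory.Balaban1983to89.B9Thm31SiteCoerciveReg335Y
import Literature.MathematicalPhysics.QuantumFieldTheory.Balaban1983to89.Node00.OpsYLocalInverse

/-!
# `Balaban1983to89.B13DirichletLocalInverseLetters` — T. Bałaban, *Propagators for lattice gauge theories in a background field*, Commun. Math. Phys.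
**99** (1985) 389–434 [Balaban1985BackgroundPropagators], Sect. C pp. 408–409 («The operators constructed for this sequence, which we denote by G′_□(U),
C_□(U) = (Q′(U)G′_□²(U)Q′\*(U))⁻¹, G_□(U), satisfy all the inequalities of Theorems 3.1–3.3»), (3.87) p. 409, Thm 3.4 p. 400, Thm 3.10 (3.107)–(3.108) p. 416,
Thm 3.11 p. 416; [Balaban1988RG2Cluster] (2.5)–(2.7) pp. 12–13, p. 15: THE DIRICHLET-COMPRESSION STATION — the local cube inverse `G′_□(U)` of pp. 408–409
ALONG A HOLOMORPHIC BACKGROUND FAMILY has the N10 entry letters on the whole coercivity ball, the centre's coercivity being the only analytic input.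

statement-level bookkeeping over LANDED theorems with citation tags; kernel-checked; [folklore] compression algebra + positional applications; nothing here is a
claim about the Yang–Mills mass gap; nothing of Bałaban's operators is asserted beyond the cited tree theorems; no node is discharged; count-neutral.

WHY THIS FILE (cell `pub-ymgap`, HUMAN RULING D-0062, Track A node N10 = [Balaban1988RG2Cluster] → N06 row 17; width seat `pub-ymgap-dag-n10-w3` g5; lane word
dag-n10-c g16 «OFFER-3 GO», N06's first refusal waived by dag-n06-j g23, bus 2026-08-28).  The N10 lane's located inverse road `G′ → X⁻¹ → R → Δ_a → G` (n10-w2∕w4∕w5∕w6,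
modules 78–84) is typed for NODE 00's GLOBAL letters (`GpY ∕ XinvY ∕ RY ∕ deltaAY ∕ GAY`); print's Theorem 3.11 ∕ Cor. 3.6 road (p. 416) and dag-n06-j's row-17 road
`hGsqA ⇐ hloc ⇐ (iii)` go through the LOCAL CUBE OPERATORS in the cube axial gauge — node00-def-Y's Dirichlet letters (`GsqY → ClocY → RlocY → deltaALocY ∕
padDeltaALocY → GAsqY`).  THIS FILE is station L1 of that road LOCALISED: the compression `dirPadY P T = P·T·P + (1 − P)` and the local inverse
`dirInvY P T = P·(dirPadY P T)⁻¹·P` of ANY holomorphic operator family with (3.108)-letters keep the letters (a diagonal 0∕1 sandwich) and a coercive centre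
(constant `min m 1`), so module 84's inverse letters on the coercivity ball apply to the compression; at `G′_□ = GsqY i parS D` this gives `G′_□`'s letters along the
pencil `A′ ↦ e^{iηA′}U₀` from Δ′_a's (module 78) and the centre's coercivity — on (3.35) both are tree theorems (78 at dag-n10-w6's fine reading; dag-n06-w1's
`trIP_deltaPrimeAY_parSymY_ge`, `m = (1∕8)L^{−2k}`).  The road's terminal station L5 will meet dag-n06-j's `hloc` slot VERBATIM:
`PosDefTr (fun _ => (1:ℝ)) (padDeltaALocY i (parSymY i) (parBY i) D (cutMulY χP) (cutMulY χ) (prodCfg 1 η A′))` for `‖A′‖ < r_□` (`posDefTr_padDeltaALocY_of_cubeGauge_smallness`,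
`posDefTr_padDeltaALocY_one_cubeDomY`, `posDefTr_padDeltaALocY_gaugeY_iff`).  LOCATED (radius): the stations are GENERIC in the chart and the background family; at the plain
sup-norm pencil the thin radius is `O(1)∕(|η|·(d+2)·L^k)` (averaging transports `(K₀e^{|η|Rc})^D`, `D = 2(d+1)(L^k − 1)`); an all-index k-uniform edition is the SAME
station at a (3.37)-scaled pencil (r06 `Cplx337` weights) — a later instance, not a rewrite.

WHAT THIS FILE PROVES (all `theorem`s; no `def`, no instance, no notation).
§1 COMPRESSION ALGEBRA in the matrix-unit product basis: `toMatrix_cutMulY` (`toMatrix (cutMulY h) = diagonal (h ∘ fst)`), `toMatrix_dirPadY_cutMulY`,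
   `toMatrix_dirInvY_cutMulY`, `rawEntryLetters_toMatrix_dirPadY` (a 0∕1 cut: letters `(R, ρ, B) ↦ (R, ρ, B + 1)`), `rawEntryLetters_toMatrix_dirInvY_of_ringInverse`
   (letters of `u ↦ (dirPadY P (T u))⁻¹` give letters of `u ↦ dirInvY P (T u)`, same triple).
§2 CENTRE: `trIP_cutMulY_self_eq` ∕ `trIP_self_eq_add_cut` (Pythagoras for a 0∕1 cut), ★ `trIP_dirPadY_cutMulY_ge` (`m`-coercive `T₀` ⟹ `min m 1`-coercive compression).
§3 ★★ `rawEntryLetters_toMatrix_dirInvY_of_coer_centre_letters` (GENERIC: letters `(R, ρ, B)` of a holomorphic `T : E → Module.End ℂ (S → M_N ℂ)`, fibre `m_F`, centre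
   coercivity `m`, a 0∕1 cut; radii `0 ≤ R′ ≤ R` with margin `m′ = min m 1 − 2·((B+1)·(m_F·c₀(1,ρ)^ν))·R′∕R > 0`, Combes–Thomas rate `0 ≤ κ ≤ ρ∕4` with
   `8(B+1)κ(m_F c₀(1,ρ∕2)^ν) ≤ m′ρ` ⟹ `RawEntryLetters (u ↦ toMatrix (dirInvY (cutMulY h) (T u))) loc R′ κ (4∕m′)`).
§4 ★★ `rawEntryLetters_toMatrix_GsqY_prodCfg_of_coer_centre_letters` (NODE 00's `G′_□ = GsqY i parS D` along the pencil about ANY background `U₀`, ANY `parS`, ANY site set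
   `D`: displayed Δ′_a pencil letters + centre coercivity ⟹ `G′_□`'s letters on the coercivity ball).
§5 ★★★ `rawEntryLetters_toMatrix_GsqY_parSymY_prodCfg_of_reg335_fineReading` (v4 letters, `G ≤ U(N)`, `U₀` in the class (3.35): BOTH inputs discharged — 78 at the
   fine reading with dag-n10-w6's numerals, dag-n06-w1's Theorem-3.1 coercivity `(1∕8)L^{−2k}`; displayed: `η`, the chart radius `Rc`, the thin radius `R′`, the rate `κ`
   and the two window inequalities between NUMBERS).
HONEST FRAMING: count-neutral Literature helper; `G′_□`'s letters on a CHART ball about `U₀` (NOT a statement about other members of (3.35)); the decay rate is the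
Combes–Thomas rate of the located road, NOT print's multi-scale (3.42); nothing of [Balaban1985BackgroundPropagators] Thms 3.1–3.3 for the cube sequence is asserted
beyond the cited tree theorems; N06 ∕ N10 NOT discharged; no registered stub proved; counts unmoved; one finite 𝕋⁴ programme at fixed ε — R4 closes the conditional
finite-𝕋⁴ rung `BalabanLadder.UV` only; nothing continuum ∕ ℝ⁴ ∕ OS ∕ mass gap ∕ Clay.  0 `sorry`, 0 `def`, standard axioms.

References: [Balaban1985BackgroundPropagators] (3.24)–(3.27) pp.394–395, (3.35)–(3.37) p.396, Thm 3.1 (3.42) p.397, Thm 3.4 p.400, (3.87) p.409, Sect. C pp.408–409,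
Thm 3.10 (3.107)–(3.108) pp.415–416, Thm 3.11 p.416; [Balaban1988RG2Cluster] (2.5)–(2.7) pp.12–13, p.15; [Balaban1984PropagatorsII] Lemma 2.1 (2.61) p.234; [AizenmanWarzel2015] §10.3.
-/

noncomputable section

namespace Literature.MathematicalPhysics.QuantumFieldTheory.Balaban1983to89.B13DirichletLocalInverseLetters

open Metric Set Finset Module
open scoped Matrix Matrix.Norms.L2Operator
open Literature.MathematicalPhysics.QuantumFieldTheory.Balaban1983to89
open Literature.MathematicalPhysics.QuantumFieldTheory.Balaban1983to89.B9Thm37GlueTorus (tdist1 tdist1_self tdist1_nonneg)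
open Literature.MathematicalPhysics.QuantumFieldTheory.Balaban1983to89.B5TorusCover (UT)
open Literature.MathematicalPhysics.QuantumFieldTheory.Balaban1983to89.B9Thm311ReadingCoords (trIP PosDefTr)
open Literature.MathematicalPhysics.QuantumFieldTheory.Balaban1983to89.B13EntrywiseWalks (RawEntryLetters)
open Literature.MathematicalPhysics.QuantumFieldTheory.Balaban1983to89.B13EntryLetterAlgebra
  (rawEntryLetters_mono rawEntryLetters_congr rawEntryLetters_add rawEntryLetters_const rawEntryLetters_diagonal_sandwich)
open Literature.MathematicalPhysics.QuantumFieldTheory.Balaban1983to89.B13InverseLettersOnCoerciveBall (rawEntryLetters_ringInverse_of_coer_centre_letters)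
open Literature.MathematicalPhysics.QuantumFieldTheory.Balaban1983to89.B13OpsYPencilXQuad (toMatrix_piProd_rect_apply)
open Literature.MathematicalPhysics.QuantumFieldTheory.Balaban1983to89.B9Thm37CubeCoverCommutators (cutMulY cutMulY_apply)
open Literature.MathematicalPhysics.QuantumFieldTheory.Balaban1983to89.B9Thm311PosViaLocalInversesY (trIP_cutMulY_right_gen trIP_cutMulY_cutMulY)
open Literature.MathematicalPhysics.QuantumFieldTheory.Balaban1983to89.B9Thm311DeltaPrimePos (trIP_add_right trIP_self_nonneg)
open Literature.MathematicalPhysics.QuantumFieldTheory.Balaban1983to89.Node00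
open Literature.MathematicalPhysics.QuantumFieldTheory.Balaban1983to89.Node00.OpsYLocalInverse (dirPadY dirInvY cubeProjY cubeIndY GsqY)

/-! ## §1. Compression algebra in the matrix-unit product basis -/

section Algebra

variable {S : Type} [Fintype S] [DecidableEq S] {N : ℕ}
variable {ν : ℕ} {Nf : Fin ν → ℕ} [∀ j, NeZero (Nf j)]
variable {E : Type*} [NormedAddCommGroup E] [NormedSpace ℂ E]

/-- the matrix of a real cut-off multiplication `M_h` in the matrix-unit product basis is the diagonal `diag(h ∘ fst)`.
[cite: Balaban1985BackgroundPropagators, (3.87) p.409 (the cut-offs h_□), bookkeeping] -/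
theorem toMatrix_cutMulY (h : S → ℝ) :
    LinearMap.toMatrix
        ((Pi.basis fun _ : S => Matrix.stdBasis ℂ (Fin N) (Fin N)).reindex (Equiv.sigmaEquivProd S (Fin N × Fin N)))
        ((Pi.basis fun _ : S => Matrix.stdBasis ℂ (Fin N) (Fin N)).reindex (Equiv.sigmaEquivProd S (Fin N × Fin N)))
        (cutMulY (𝔸 := Matrix (Fin N) (Fin N) ℂ) h) =
      Matrix.diagonal fun p : S × (Fin N × Fin N) => ((h p.1 : ℝ) : ℂ) := by
  ext p q
  rw [toMatrix_piProd_rect_apply, cutMulY_apply, Matrix.diagonal_apply]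
  by_cases h1 : p.1 = q.1
  · rw [← h1, Pi.single_eq_same, map_smul, Basis.repr_self, Finsupp.smul_apply, Finsupp.single_apply, smul_eq_mul]
    by_cases h2 : p.2 = q.2
    · have hpq : p = q := Prod.ext h1 h2
      rw [if_pos h2.symm, if_pos hpq, mul_one]
    · have hpq : p ≠ q := fun hpq => h2 (congrArg Prod.snd hpq)
      rw [if_neg (Ne.symm h2), if_neg hpq, mul_zero]
  · have hpq : p ≠ q := fun hpq => h1 (congrArg Prod.fst hpq)
    rw [Pi.single_eq_of_ne h1, smul_zero, map_zero, Finsupp.zero_apply, if_neg hpq]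

/-- the matrix of the PADDED COMPRESSION `P T P + (1 − P)`, `P = M_h`: `diag(h)·M·diag(h) + diag(1 − h)`.
[cite: Balaban1985BackgroundPropagators, pp.408–409 (the sequence {Ω_n(□)}: Dirichlet data outside □̃), (3.87) p.409] -/
theorem toMatrix_dirPadY_cutMulY (h : S → ℝ) (T : Module.End ℂ (S → Matrix (Fin N) (Fin N) ℂ)) :
    LinearMap.toMatrix
        ((Pi.basis fun _ : S => Matrix.stdBasis ℂ (Fin N) (Fin N)).reindex (Equiv.sigmaEquivProd S (Fin N × Fin N)))
        ((Pi.basis fun _ : S => Matrix.stdBasis ℂ (Fin N) (Fin N)).reindex (Equiv.sigmaEquivProd S (Fin N × Fin N)))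
        (dirPadY (cutMulY h) T) =
      (Matrix.diagonal fun p : S × (Fin N × Fin N) => ((h p.1 : ℝ) : ℂ)) *
          LinearMap.toMatrix
            ((Pi.basis fun _ : S => Matrix.stdBasis ℂ (Fin N) (Fin N)).reindex (Equiv.sigmaEquivProd S (Fin N × Fin N)))
            ((Pi.basis fun _ : S => Matrix.stdBasis ℂ (Fin N) (Fin N)).reindex (Equiv.sigmaEquivProd S (Fin N × Fin N))) T *
          (Matrix.diagonal fun p : S × (Fin N × Fin N) => ((h p.1 : ℝ) : ℂ)) +
        Matrix.diagonal fun p : S × (Fin N × Fin N) => (1 : ℂ) - ((h p.1 : ℝ) : ℂ) := by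
  rw [dirPadY, map_add, map_sub, LinearMap.toMatrix_mul, LinearMap.toMatrix_mul, LinearMap.toMatrix_one, toMatrix_cutMulY,
    ← Matrix.diagonal_one, ← Matrix.diagonal_sub]

/-- the matrix of the LOCAL INVERSE `P (P T P + 1 − P)⁻¹ P`: `diag(h)·(…)⁻¹·diag(h)`. [cite: Balaban1985BackgroundPropagators, pp.408–409 (G′_□(U)), (3.87) p.409] -/
theorem toMatrix_dirInvY_cutMulY (h : S → ℝ) (T : Module.End ℂ (S → Matrix (Fin N) (Fin N) ℂ)) :
    LinearMap.toMatrix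
        ((Pi.basis fun _ : S => Matrix.stdBasis ℂ (Fin N) (Fin N)).reindex (Equiv.sigmaEquivProd S (Fin N × Fin N)))
        ((Pi.basis fun _ : S => Matrix.stdBasis ℂ (Fin N) (Fin N)).reindex (Equiv.sigmaEquivProd S (Fin N × Fin N)))
        (dirInvY (cutMulY h) T) =
      (Matrix.diagonal fun p : S × (Fin N × Fin N) => ((h p.1 : ℝ) : ℂ)) *
          LinearMap.toMatrix
            ((Pi.basis fun _ : S => Matrix.stdBasis ℂ (Fin N) (Fin N)).reindex (Equiv.sigmaEquivProd S (Fin N × Fin N)))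
            ((Pi.basis fun _ : S => Matrix.stdBasis ℂ (Fin N) (Fin N)).reindex (Equiv.sigmaEquivProd S (Fin N × Fin N)))
            (Ring.inverse (dirPadY (cutMulY h) T)) *
        (Matrix.diagonal fun p : S × (Fin N × Fin N) => ((h p.1 : ℝ) : ℂ)) := by
  rw [dirInvY, LinearMap.toMatrix_mul, LinearMap.toMatrix_mul, toMatrix_cutMulY]

variable {T : E → Module.End ℂ (S → Matrix (Fin N) (Fin N) ℂ)} {loc : S × (Fin N × Fin N) → UT Nf} {R ρ B : ℝ}

/-- ★ **A 0∕1 DIRICHLET COMPRESSION KEEPS THE LETTERS** (`(R, ρ, B) ↦ (R, ρ, B + 1)`): the cut is a diagonal sandwich of norm `≤ 1` (no rate loss), the padding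
`diag(1 − h)` a `u`-constant diagonal 0∕1 matrix. [cite: Balaban1985BackgroundPropagators, (3.87) p.409, Thm 3.10 (3.108) p.416; Balaban1988RG2Cluster, (2.5) p.12] -/
theorem rawEntryLetters_toMatrix_dirPadY
    (hA : RawEntryLetters (fun u => LinearMap.toMatrix
        ((Pi.basis fun _ : S => Matrix.stdBasis ℂ (Fin N) (Fin N)).reindex (Equiv.sigmaEquivProd S (Fin N × Fin N)))
        ((Pi.basis fun _ : S => Matrix.stdBasis ℂ (Fin N) (Fin N)).reindex (Equiv.sigmaEquivProd S (Fin N × Fin N))) (T u)) loc R ρ B)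
    (hρ : 0 ≤ ρ) {h : S → ℝ} (hh : ∀ s, h s = 0 ∨ h s = 1) :
    RawEntryLetters (fun u => LinearMap.toMatrix
        ((Pi.basis fun _ : S => Matrix.stdBasis ℂ (Fin N) (Fin N)).reindex (Equiv.sigmaEquivProd S (Fin N × Fin N)))
        ((Pi.basis fun _ : S => Matrix.stdBasis ℂ (Fin N) (Fin N)).reindex (Equiv.sigmaEquivProd S (Fin N × Fin N))) (dirPadY (cutMulY h) (T u)))
      loc R ρ (B + 1) := by
  have hle : ∀ p : S × (Fin N × Fin N), ‖(((h p.1 : ℝ) : ℂ))‖ ≤ 1 := fun p => by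
    rcases hh p.1 with h0 | h1
    · rw [h0]; simp
    · rw [h1]; simp
  have hsand := rawEntryLetters_diagonal_sandwich hA hρ hle hle
  have hpad : RawEntryLetters (fun _ : E => Matrix.diagonal fun p : S × (Fin N × Fin N) => (1 : ℂ) - ((h p.1 : ℝ) : ℂ)) loc R ρ 1 := by
    refine rawEntryLetters_const loc R zero_le_one fun p q => ?_
    by_cases hpq : p = q
    · subst hpq
      rw [Matrix.diagonal_apply_eq, tdist1_self, mul_zero, neg_zero, Real.exp_zero, mul_one]
      rcases hh p.1 with h0 | h1
      · rw [h0]; simp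
      · rw [h1]; simp
    · rw [Matrix.diagonal_apply_ne _ hpq, norm_zero]; positivity
  refine rawEntryLetters_congr (rawEntryLetters_add hsand hpad) fun u _ => ?_
  rw [toMatrix_dirPadY_cutMulY]

/-- **THE LOCAL INVERSE's LETTERS FROM THE PADDED INVERSE's**: letters of `u ↦ (P T(u) P + 1 − P)⁻¹` give letters of `u ↦ dirInvY P (T u)` (same triple; diagonal
sandwich by the cut). [cite: Balaban1985BackgroundPropagators, pp.408–409 (G′_□(U)), (3.87) p.409, (3.108) p.416] -/
theorem rawEntryLetters_toMatrix_dirInvY_of_ringInverse {h : S → ℝ} (hh : ∀ s, h s = 0 ∨ h s = 1) {R' κ B' : ℝ}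
    (hI : RawEntryLetters (fun u => LinearMap.toMatrix
        ((Pi.basis fun _ : S => Matrix.stdBasis ℂ (Fin N) (Fin N)).reindex (Equiv.sigmaEquivProd S (Fin N × Fin N)))
        ((Pi.basis fun _ : S => Matrix.stdBasis ℂ (Fin N) (Fin N)).reindex (Equiv.sigmaEquivProd S (Fin N × Fin N)))
        (Ring.inverse (dirPadY (cutMulY h) (T u)))) loc R' κ B')
    (hκ : 0 ≤ κ) :
    RawEntryLetters (fun u => LinearMap.toMatrix
        ((Pi.basis fun _ : S => Matrix.stdBasis ℂ (Fin N) (Fin N)).reindex (Equiv.sigmaEquivProd S (Fin N × Fin N)))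
        ((Pi.basis fun _ : S => Matrix.stdBasis ℂ (Fin N) (Fin N)).reindex (Equiv.sigmaEquivProd S (Fin N × Fin N))) (dirInvY (cutMulY h) (T u)))
      loc R' κ B' := by
  have hle : ∀ p : S × (Fin N × Fin N), ‖(((h p.1 : ℝ) : ℂ))‖ ≤ 1 := fun p => by
    rcases hh p.1 with h0 | h1
    · rw [h0]; simp
    · rw [h1]; simp
  refine rawEntryLetters_congr (rawEntryLetters_diagonal_sandwich hI hκ hle hle) fun u _ => ?_
  rw [toMatrix_dirInvY_cutMulY]

end Algebra

/-! ## §2. The centre: a 0∕1 Dirichlet compression of an `m`-coercive operator is `min m 1`-coercive -/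

section Centre

variable {S : Type} [Fintype S] {N : ℕ}

/-- `⟨Ψ, M_hΨ⟩₁ = ⟨M_hΨ, M_hΨ⟩₁` for a 0∕1 cut (`h² = h`). [cite: Balaban1985BackgroundPropagators, (3.87) p.409, p.393 (scalar products); bookkeeping] -/
theorem trIP_cutMulY_self_eq {h : S → ℝ} (hh : ∀ s, h s = 0 ∨ h s = 1) (Ψ : S → Matrix (Fin N) (Fin N) ℂ) :
    trIP (fun _ => (1 : ℝ)) Ψ (cutMulY h Ψ) = trIP (fun _ => (1 : ℝ)) (cutMulY h Ψ) (cutMulY h Ψ) := by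
  have hsq : (fun z => h z * h z) = h := funext fun z => by rcases hh z with h0 | h0 <;> simp [h0]
  rw [trIP_cutMulY_cutMulY, hsq]

omit [Fintype S] in
/-- the complementary cut `1 − h` is again 0∕1 and `M_{1−h} = 1 − M_h`. [cite: Balaban1985BackgroundPropagators, (3.87) p.409; bookkeeping] -/
theorem cutMulY_one_sub_apply (h : S → ℝ) (Ψ : S → Matrix (Fin N) (Fin N) ℂ) :
    cutMulY (fun z => 1 - h z) Ψ = Ψ - cutMulY h Ψ := by
  funext z
  simp only [cutMulY_apply, Pi.sub_apply, Complex.ofReal_sub, Complex.ofReal_one, sub_smul, one_smul]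

/-- **PYTHAGORAS FOR A 0∕1 CUT**: `⟨Ψ,Ψ⟩₁ = ⟨M_hΨ, M_hΨ⟩₁ + ⟨(1−M_h)Ψ, (1−M_h)Ψ⟩₁`. [cite: Balaban1985BackgroundPropagators, p.393 (scalar products), (3.87) p.409; bookkeeping] -/
theorem trIP_self_eq_add_cut {h : S → ℝ} (hh : ∀ s, h s = 0 ∨ h s = 1) (Ψ : S → Matrix (Fin N) (Fin N) ℂ) :
    trIP (fun _ => (1 : ℝ)) Ψ Ψ =
      trIP (fun _ => (1 : ℝ)) (cutMulY h Ψ) (cutMulY h Ψ) + trIP (fun _ => (1 : ℝ)) (Ψ - cutMulY h Ψ) (Ψ - cutMulY h Ψ) := by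
  have hh' : ∀ s, (fun z => 1 - h z) s = 0 ∨ (fun z => 1 - h z) s = 1 := fun s => by
    rcases hh s with h0 | h1
    · right; simp [h0]
    · left; simp [h1]
  have h2 := trIP_cutMulY_self_eq hh' Ψ
  rw [cutMulY_one_sub_apply] at h2
  rw [← h2, ← trIP_cutMulY_self_eq hh Ψ]
  -- `⟨Ψ, Ψ − M_hΨ⟩ = ⟨Ψ,Ψ⟩ − ⟨Ψ, M_hΨ⟩`
  have hsplit : trIP (fun _ => (1 : ℝ)) Ψ Ψ = trIP (fun _ => (1 : ℝ)) Ψ (cutMulY h Ψ + (Ψ - cutMulY h Ψ)) := by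
    rw [add_sub_cancel]
  rw [hsplit, trIP_add_right]

/-- ★ **THE CENTRE OF THE COMPRESSION**: if `m·⟨Ψ,Ψ⟩₁ ≤ ⟨Ψ, T₀Ψ⟩₁` for all `Ψ` and `h` is a 0∕1 cut, then `min m 1·⟨Ψ,Ψ⟩₁ ≤ ⟨Ψ, (M_h T₀ M_h + 1 − M_h)Ψ⟩₁` — the
compression is coercive on the range of the cut by `T₀` and on its complement by the identity ([Balaban1985BackgroundPropagators] p. 409: the operators of the cube
sequence «satisfy all the inequalities of Theorems 3.1–3.3» — here only the lower bound, from the global one).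
[cite: Balaban1985BackgroundPropagators, pp.408–409, Thm 3.11 p.416; Balaban1984PropagatorsII, (2.69) p.235] -/
theorem trIP_dirPadY_cutMulY_ge (T₀ : Module.End ℂ (S → Matrix (Fin N) (Fin N) ℂ)) {m : ℝ}
    (hco : ∀ Ψ : S → Matrix (Fin N) (Fin N) ℂ, m * trIP (fun _ => (1 : ℝ)) Ψ Ψ ≤ trIP (fun _ => (1 : ℝ)) Ψ (T₀ Ψ))
    {h : S → ℝ} (hh : ∀ s, h s = 0 ∨ h s = 1) :
    ∀ Ψ : S → Matrix (Fin N) (Fin N) ℂ, min m 1 * trIP (fun _ => (1 : ℝ)) Ψ Ψ ≤ trIP (fun _ => (1 : ℝ)) Ψ (dirPadY (cutMulY h) T₀ Ψ) := by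
  intro Ψ
  have hexp : dirPadY (cutMulY h) T₀ Ψ = cutMulY h (T₀ (cutMulY h Ψ)) + (Ψ - cutMulY h Ψ) := by
    rw [dirPadY]
    simp only [LinearMap.add_apply, LinearMap.sub_apply, Module.End.mul_apply, Module.End.one_apply]
  rw [hexp, trIP_add_right, trIP_cutMulY_right_gen]
  have hP := hco (cutMulY h Ψ)
  have hpy := trIP_self_eq_add_cut hh Ψ
  -- `⟨Ψ, Ψ − M_hΨ⟩ = ⟨Ψ − M_hΨ, Ψ − M_hΨ⟩`
  have hQ : trIP (fun _ => (1 : ℝ)) Ψ (Ψ - cutMulY h Ψ) = trIP (fun _ => (1 : ℝ)) (Ψ - cutMulY h Ψ) (Ψ - cutMulY h Ψ) := by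
    have hh' : ∀ s, (fun z => 1 - h z) s = 0 ∨ (fun z => 1 - h z) s = 1 := fun s => by
      rcases hh s with h0 | h1
      · right; simp [h0]
      · left; simp [h1]
    have h2 := trIP_cutMulY_self_eq hh' Ψ
    rwa [cutMulY_one_sub_apply] at h2
  rw [hQ]
  have ha : 0 ≤ trIP (fun _ => (1 : ℝ)) (cutMulY h Ψ) (cutMulY h Ψ) := trIP_self_nonneg _ (fun _ => one_pos) _
  have hb : 0 ≤ trIP (fun _ => (1 : ℝ)) (Ψ - cutMulY h Ψ) (Ψ - cutMulY h Ψ) := trIP_self_nonneg _ (fun _ => one_pos) _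
  have hm1 : min m 1 ≤ m := min_le_left _ _
  have hm2 : min m 1 ≤ 1 := min_le_right _ _
  rw [hpy]
  nlinarith [mul_le_mul_of_nonneg_right hm1 ha, mul_le_mul_of_nonneg_right hm2 hb]

end Centre

/-! ## §3. ★★ The local inverse's letters on the whole coercivity ball (generic holomorphic families) -/

section Generic

variable {S : Type} [Fintype S] [DecidableEq S] {N : ℕ}
variable {ν : ℕ} {Nf : Fin ν → ℕ} [∀ j, NeZero (Nf j)]
variable {E : Type*} [NormedAddCommGroup E] [NormedSpace ℂ E]

/-- ★★ **THE DIRICHLET LOCAL INVERSE OF A HOLOMORPHIC FAMILY HAS THE LETTERS ON THE WHOLE COERCIVITY BALL.**  Let `T : E → Module.End ℂ (S → M_N(ℂ))` carry the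
product-basis letters `(R, ρ, B)` (`0 < ρ`), `loc` with fibres `≤ m_F`, a coercive centre `m·⟨Ψ,Ψ⟩₁ ≤ ⟨Ψ, T(0)Ψ⟩₁`, and let `h` be a 0∕1 cut (`P = M_h`).  For radii
`0 ≤ R′ ≤ R` with margin `m′ = min m 1 − 2·((B+1)·(m_F·c₀(1,ρ)^ν))·R′∕R > 0` and a Combes–Thomas rate `0 ≤ κ ≤ ρ∕4`, `8·(B+1)·κ·(m_F·c₀(1,ρ∕2)^ν) ≤ m′·ρ`:
`RawEntryLetters (u ↦ toMatrix (dirInvY P (T u))) loc R′ κ (4∕m′)` — module 84 at the compression (§1 letters, §2 centre), then the cut sandwich.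
[cite: Balaban1985BackgroundPropagators, pp.408–409 (G′_□, C_□, G_□), (3.87) p.409, Thm 3.4 p.400, Thm 3.10 (3.108) p.416, Thm 3.11 p.416; Balaban1988RG2Cluster, (2.7) p.13, p.15;
Balaban1984PropagatorsII, Lemma 2.1 (2.61) p.234; AizenmanWarzel2015, §10.3] -/
theorem rawEntryLetters_toMatrix_dirInvY_of_coer_centre_letters (T : E → Module.End ℂ (S → Matrix (Fin N) (Fin N) ℂ))
    {loc : S × (Fin N × Fin N) → UT Nf} {R R' ρ B m : ℝ}
    (hA : RawEntryLetters (fun u => LinearMap.toMatrix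
        ((Pi.basis fun _ : S => Matrix.stdBasis ℂ (Fin N) (Fin N)).reindex (Equiv.sigmaEquivProd S (Fin N × Fin N)))
        ((Pi.basis fun _ : S => Matrix.stdBasis ℂ (Fin N) (Fin N)).reindex (Equiv.sigmaEquivProd S (Fin N × Fin N))) (T u)) loc R ρ B)
    (hρ : 0 < ρ) {mF : ℕ} (hfib : ∀ y : UT Nf, (univ.filter fun k => loc k = y).card ≤ mF)
    (hco : ∀ Ψ : S → Matrix (Fin N) (Fin N) ℂ, m * trIP (fun _ => (1 : ℝ)) Ψ Ψ ≤ trIP (fun _ => (1 : ℝ)) Ψ (T 0 Ψ))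
    {h : S → ℝ} (hh : ∀ s, h s = 0 ∨ h s = 1)
    (hR' : 0 ≤ R') (hR'R : R' ≤ R) (hmarg : 0 < min m 1 - 2 * ((B + 1) * (mF * B6.c0 1 ρ ^ ν)) * R' / R)
    {κ : ℝ} (hκ : 0 ≤ κ) (hκ4 : κ ≤ ρ / 4)
    (hκm : 8 * (B + 1) * κ * (mF * B6.c0 1 (ρ / 2) ^ ν) ≤ (min m 1 - 2 * ((B + 1) * (mF * B6.c0 1 ρ ^ ν)) * R' / R) * ρ) :
    RawEntryLetters (fun u => LinearMap.toMatrix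
        ((Pi.basis fun _ : S => Matrix.stdBasis ℂ (Fin N) (Fin N)).reindex (Equiv.sigmaEquivProd S (Fin N × Fin N)))
        ((Pi.basis fun _ : S => Matrix.stdBasis ℂ (Fin N) (Fin N)).reindex (Equiv.sigmaEquivProd S (Fin N × Fin N))) (dirInvY (cutMulY h) (T u))) loc R'
      κ (4 / (min m 1 - 2 * ((B + 1) * (mF * B6.c0 1 ρ ^ ν)) * R' / R)) := by
  have hpad := rawEntryLetters_toMatrix_dirPadY hA hρ.le hh
  have hco' := trIP_dirPadY_cutMulY_ge (T 0) hco hh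
  -- the family argument of module 84 is left to unification (`_`): an explicitly re-elaborated lambda makes `isDefEq` unfold `cutMulY` pointwise
  have hinv := rawEntryLetters_ringInverse_of_coer_centre_letters _ hpad hρ hfib hco' hR' hR'R hmarg hκ hκ4 hκm
  exact rawEntryLetters_toMatrix_dirInvY_of_ringInverse hh hinv hκ

end Generic

/-! ## §4. ★★ NODE 00's local cube inverse `G′_□ = GsqY` along the pencil, on the coercivity ball about any background -/

section Pencil

open Literature.MathematicalPhysics.QuantumFieldTheory.Balaban1983to89.B9Eq39Adjoint (prodCfg)
open Literature.MathematicalPhysics.QuantumFieldTheory.Balaban1983to89.B9Eq369Product (prodCfg_zero)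
open Literature.MathematicalPhysics.QuantumFieldTheory.Balaban1983to89.B6GlobalChartV1 (PV)
open Literature.MathematicalPhysics.QuantumFieldTheory.Balaban1983to89.B6KLevelCensusIndexV1 (KIdx)

variable {d ℓ : ℕ} {hd : 1 ≤ d + 1} {hL : Odd (ℓ + 1) ∧ 1 < ℓ + 1} {b₀ b₁ : ℝ}
variable (i : KIdx d ℓ hd hL b₀ b₁) {N : ℕ}
variable {ν : ℕ} {Nf : Fin ν → ℕ} [∀ j, NeZero (Nf j)]

/-- the cube indicator is a 0∕1 cut. [cite: Balaban1985BackgroundPropagators, pp.408–409 (□̃), bookkeeping] -/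
theorem cubeIndY_zero_or_one (D : Finset (SiteY i)) (z : SiteY i) : cubeIndY i D z = 0 ∨ cubeIndY i D z = 1 := by
  unfold cubeIndY
  by_cases hz : z ∈ D
  · right; rw [if_pos hz]
  · left; rw [if_neg hz]

/-- ★★ **`G′_□(e^{iηA′}U₀)` IN N10 COORDINATES ON THE COERCIVITY BALL** (ANY transporter letter `parS`, ANY site set `D = □̃`, ANY background `U₀`): from Δ′_a's pencil
letters `hA′ : RawEntryLetters (A′ ↦ toMatrix (Δ′_a(e^{iηA′}U₀))) loc R ρ B` (module 78), a fibre bound `m_F`, the centre's coercivity `m·⟨Ψ,Ψ⟩₁ ≤ ⟨Ψ, Δ′_a(U₀)Ψ⟩₁`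
([Balaban1985BackgroundPropagators] Thm 3.1 at the ONE background `U₀`) and §3's window ⟹
`RawEntryLetters (A′ ↦ toMatrix (G′_□(e^{iηA′}U₀))) loc R′ κ (4∕m′)`, `G′_□ = GsqY i parS D = dirInvY (cubeProjY i D) ∘ Δ′_a` (node00-def-Y, W-a file A-0).
[cite: Balaban1985BackgroundPropagators, pp.408–409 (G′_□(U)), (3.87) p.409, (3.24)–(3.25) pp.394–395, Thm 3.1 (3.42) p.397, Thm 3.4 p.400, Thm 3.10 (3.108) p.416, Thm 3.11 p.416;
Balaban1988RG2Cluster, (2.5)–(2.7) pp.12–13, p.15] -/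
theorem rawEntryLetters_toMatrix_GsqY_prodCfg_of_coer_centre_letters (parS : SiteParY (Matrix (Fin N) (Fin N) ℂ) i) (D : Finset (SiteY i))
    (U₀ : CfgY (Matrix (Fin N) (Fin N) ℂ) i) (η : ℝ) {loc : SiteY i × (Fin N × Fin N) → UT Nf} {R R' ρ B m : ℝ}
    (hA : RawEntryLetters (fun a : Fin (d + 1) → Site (PV d ℓ i.m i.K hd hL) 0 → Matrix (Fin N) (Fin N) ℂ =>
      LinearMap.toMatrix
        ((Pi.basis fun _ : SiteY i => Matrix.stdBasis ℂ (Fin N) (Fin N)).reindex (Equiv.sigmaEquivProd (SiteY i) (Fin N × Fin N)))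
        ((Pi.basis fun _ : SiteY i => Matrix.stdBasis ℂ (Fin N) (Fin N)).reindex (Equiv.sigmaEquivProd (SiteY i) (Fin N × Fin N)))
        (deltaPrimeAY i parS (prodCfg U₀ η a))) loc R ρ B)
    (hρ : 0 < ρ) {mF : ℕ} (hfib : ∀ y : UT Nf, (univ.filter fun k => loc k = y).card ≤ mF)
    (hco : ∀ Ψ : SiteY i → Matrix (Fin N) (Fin N) ℂ, m * trIP (fun _ => (1 : ℝ)) Ψ Ψ ≤ trIP (fun _ => (1 : ℝ)) Ψ (deltaPrimeAY i parS U₀ Ψ))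
    (hR' : 0 ≤ R') (hR'R : R' ≤ R) (hmarg : 0 < min m 1 - 2 * ((B + 1) * (mF * B6.c0 1 ρ ^ ν)) * R' / R)
    {κ : ℝ} (hκ : 0 ≤ κ) (hκ4 : κ ≤ ρ / 4)
    (hκm : 8 * (B + 1) * κ * (mF * B6.c0 1 (ρ / 2) ^ ν) ≤ (min m 1 - 2 * ((B + 1) * (mF * B6.c0 1 ρ ^ ν)) * R' / R) * ρ) :
    RawEntryLetters (fun a : Fin (d + 1) → Site (PV d ℓ i.m i.K hd hL) 0 → Matrix (Fin N) (Fin N) ℂ =>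
        LinearMap.toMatrix
          ((Pi.basis fun _ : SiteY i => Matrix.stdBasis ℂ (Fin N) (Fin N)).reindex (Equiv.sigmaEquivProd (SiteY i) (Fin N × Fin N)))
          ((Pi.basis fun _ : SiteY i => Matrix.stdBasis ℂ (Fin N) (Fin N)).reindex (Equiv.sigmaEquivProd (SiteY i) (Fin N × Fin N)))
          (GsqY i parS D (prodCfg U₀ η a))) loc R'
      κ (4 / (min m 1 - 2 * ((B + 1) * (mF * B6.c0 1 ρ ^ ν)) * R' / R)) := by
  have hco0 : ∀ Ψ : SiteY i → Matrix (Fin N) (Fin N) ℂ,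
      m * trIP (fun _ => (1 : ℝ)) Ψ Ψ ≤ trIP (fun _ => (1 : ℝ)) Ψ (deltaPrimeAY i parS (prodCfg U₀ η 0) Ψ) := by
    intro Ψ; rw [prodCfg_zero]; exact hco Ψ
  exact rawEntryLetters_toMatrix_dirInvY_of_coer_centre_letters _ hA hρ hfib hco0 (cubeIndY_zero_or_one i D) hR' hR'R hmarg hκ hκ4 hκm

end Pencil

/-! ## §5. ★★★ On the class (3.35): both inputs discharged (v4 letters, fine reading) -/

section Reg335

open Literature.MathematicalPhysics.QuantumFieldTheory.Balaban1983to89.B9Eq39Adjoint (prodCfg)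
open Literature.MathematicalPhysics.QuantumFieldTheory.Balaban1983to89.B6GlobalChartV1 (PV)
open Literature.MathematicalPhysics.QuantumFieldTheory.Balaban1983to89.B6KLevelCensusIndexV1 (KIdx kGeo)
open Literature.MathematicalPhysics.QuantumFieldTheory.Balaban1983to89.B9BackgroundsKLevelV1 (bg9K)
open Literature.MathematicalPhysics.QuantumFieldTheory.Balaban1983to89.B13OpsYPencilGreenPrimeSym (rawEntryLetters_toMatrix_deltaPrimeAY_parSymY_prodCfg)
open Literature.MathematicalPhysics.QuantumFieldTheory.Balaban1983to89.B13GreenPrimeSymLettersOfReg335 (norm_unit_le_one_of_mem)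
open Literature.MathematicalPhysics.QuantumFieldTheory.Balaban1983to89.B13MatrixUnitBasisNumerals (norm_stdBasis_repr_le norm_stdBasis_le_one)
open Literature.MathematicalPhysics.QuantumFieldTheory.Balaban1983to89.B13SiteReadingNumerals
  (fineReadingY hD_avgCoeffY hℓ_fineReadingY hℓa_fineReadingY hfib_fineReadingY_matrixUnits)
open Literature.MathematicalPhysics.QuantumFieldTheory.Balaban1983to89.B9Thm31SiteCoerciveReg335Y (trIP_deltaPrimeAY_parSymY_ge)

variable {d ℓ : ℕ} {hd : 1 ≤ d + 1} {hL : Odd (ℓ + 1) ∧ 1 < ℓ + 1} {b₀ b₁ : ℝ}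
variable (i : KIdx d ℓ hd hL b₀ b₁) {N : ℕ} {G : Subgroup (Matrix (Fin N) (Fin N) ℂ)ˣ}

/-- ★★★ **`G′_□` ALONG THE PENCIL ABOUT A (3.35) BACKGROUND — NO DISPLAYED N06 HYPOTHESIS** (v4 letters `parSymY`, `G ≤ U(N)`, `U₀` in the class (3.35) with
`0 ≤ c·M·α₀`, `c·M·α₀·(d+1) ≤ 1∕16`; ANY site set `D = □̃`): Δ′_a's pencil letters are module 78's at dag-n10-w6's FINE reading (`K₀ = 1`, matrix units `cb = cl = 1`,
`Cavg = 1`, `D_avg = 2(d+1)(L^k − 1)`, `s = (d+1)L^k`, fibre `N²`), the centre is dag-n06-w1's Theorem 3.1 coercivity `m = (1∕8)·(L^k)^{−2}` of `Δ′_a(U₀)`; displayed: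
`η`, the chart radius `Rc > 0`, the letters' rate `ρ > 0`, the thin radius `0 ≤ R′ ≤ Rc`, the Combes–Thomas rate `κ` and the two window inequalities between NUMBERS
(margin `m′ = min m 1 − 2·((B+1)·(N²·c₀(1,ρ)^{d+1}))·R′∕Rc > 0`, `8(B+1)κ(N² c₀(1,ρ∕2)^{d+1}) ≤ m′ρ`, `B` = 78's constant at these numerals) ⟹
`RawEntryLetters (A′ ↦ toMatrix (G′_□(e^{iηA′}U₀))) (ℓ_fine ∘ fst) R′ κ (4∕m′)` — the LOCAL twin of dag-n10-w6's `…GpY_parSymY_prodCfg_of_reg335_fineReading_record`.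
[cite: Balaban1985BackgroundPropagators, pp.408–409 (G′_□(U)), (3.87) p.409, (3.35) p.396, Thm 3.1 (3.42) p.397, Thm 3.4 p.400, Thm 3.10 (3.107)–(3.108) p.416;
Balaban1988RG2Cluster, (2.5)–(2.7) pp.12–13, p.15; Balaban1984PropagatorsII, Lemma 2.1 (2.61) p.234] -/
theorem rawEntryLetters_toMatrix_GsqY_parSymY_prodCfg_of_reg335_fineReading [NeZero N]
    (hG : G ≤ B7Prop2Explicit.unitaryUnits (Matrix (Fin N) (Fin N) ℂ))
    {U₀ : CfgY (Matrix (Fin N) (Fin N) ℂ) i} {c α₀ : ℝ} (hC0 : 0 ≤ c * (kGeo i).M * α₀) (hC1 : c * (kGeo i).M * α₀ * ((d : ℝ) + 1) ≤ 1 / 16)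
    (hreg : (bg9K (Matrix (Fin N) (Fin N) ℂ) G i).Reg335 c α₀ U₀) (D : Finset (SiteY i))
    (η : ℝ) {Rc : ℝ} (hRc : 0 ≤ Rc) {ρ : ℝ} (hρ : 0 < ρ)
    -- module 78's letters constant at the fine-reading numerals, bound once by an equation binder (`rfl` at the call site)
    {B : ℝ} (hB : B = (1 * (((d : ℝ) + 1) *
          (1 * Real.exp (|η| * Rc) * (1 * Real.exp (|η| * Rc) * 1 * (1 * Real.exp (|η| * Rc)) + 1) * (1 * Real.exp (|η| * Rc)) +
            (1 * Real.exp (|η| * Rc) * 1 * (1 * Real.exp (|η| * Rc)) + 1)) +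
          1 * ((1 * Real.exp (|η| * Rc)) ^ (2 * (d + 1) * ((ℓ + 1) ^ i.k - 1)) * 1 * (1 * Real.exp (|η| * Rc)) ^ (2 * (d + 1) * ((ℓ + 1) ^ i.k - 1)))) *
          Real.exp (ρ * (((d : ℝ) + 1) * ((((ℓ + 1) ^ i.k : ℕ) : ℝ))))))
    {R' : ℝ} (hR' : 0 ≤ R') (hR'R : R' ≤ Rc)
    (hmarg : 0 < min ((1 / 8 : ℝ) * (((((ℓ + 1) ^ i.k : ℕ) : ℝ)) ^ 2)⁻¹) 1 - 2 * ((B + 1) * ((N * N : ℕ) * B6.c0 1 ρ ^ (d + 1))) * R' / Rc)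
    {κ : ℝ} (hκ : 0 ≤ κ) (hκ4 : κ ≤ ρ / 4)
    (hκm : 8 * (B + 1) * κ * ((N * N : ℕ) * B6.c0 1 (ρ / 2) ^ (d + 1)) ≤
      (min ((1 / 8 : ℝ) * (((((ℓ + 1) ^ i.k : ℕ) : ℝ)) ^ 2)⁻¹) 1 - 2 * ((B + 1) * ((N * N : ℕ) * B6.c0 1 ρ ^ (d + 1))) * R' / Rc) * ρ) :
    RawEntryLetters (fun a : Fin (d + 1) → Site (PV d ℓ i.m i.K hd hL) 0 → Matrix (Fin N) (Fin N) ℂ =>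
        LinearMap.toMatrix
          ((Pi.basis fun _ : SiteY i => Matrix.stdBasis ℂ (Fin N) (Fin N)).reindex (Equiv.sigmaEquivProd (SiteY i) (Fin N × Fin N)))
          ((Pi.basis fun _ : SiteY i => Matrix.stdBasis ℂ (Fin N) (Fin N)).reindex (Equiv.sigmaEquivProd (SiteY i) (Fin N × Fin N)))
          (GsqY i (parSymY i) D (prodCfg U₀ η a)))
      (fun p : SiteY i × (Fin N × Fin N) => fineReadingY i i.hN p.1) R'
      κ (4 / (min ((1 / 8 : ℝ) * (((((ℓ + 1) ^ i.k : ℕ) : ℝ)) ^ 2)⁻¹) 1 - 2 * ((B + 1) * ((N * N : ℕ) * B6.c0 1 ρ ^ (d + 1))) * R' / Rc)) := by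
  subst hB
  obtain ⟨hU, hUi⟩ := norm_unit_le_one_of_mem i hG hreg.1
  have hs0 : (0 : ℝ) ≤ ((d : ℝ) + 1) * ((((ℓ + 1) ^ i.k : ℕ) : ℝ)) := by positivity
  have hA := rawEntryLetters_toMatrix_deltaPrimeAY_parSymY_prodCfg i U₀ η (Matrix.stdBasis ℂ (Fin N) (Fin N)) hU hUi le_rfl hRc (hD_avgCoeffY i)
    zero_le_one (B9Thm37CubeCoverCommutatorSizes.sum_abs_avgCoeffY_le_one i) norm_stdBasis_repr_le zero_le_one norm_stdBasis_le_one zero_le_one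
    (fineReadingY i i.hN) hs0 (hℓ_fineReadingY i i.hN) (hℓa_fineReadingY i i.hN) hρ.le
  exact rawEntryLetters_toMatrix_GsqY_prodCfg_of_coer_centre_letters i (parSymY i) D U₀ η hA hρ (hfib_fineReadingY_matrixUnits i i.hN)
    (trIP_deltaPrimeAY_parSymY_ge i hG hC0 hC1 hreg) hR' hR'R hmarg hκ hκ4 hκm

end Reg335

end Literature.MathematicalPhysics.QuantumFieldTheory.Balaban1983to89.B13DirichletLocalInverseLetters
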